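import Mathlib
import HarnessLib
import Summits.CriticalPhenomena.CardyFormulaZ2.Theorems.CardyComplexConeEdgeCoherenceLeeYangLaurent

/-!
# Stub `stub_identification` of line `Sketch` (composition `LeeYang`) for crux `CardyComplexCone.EdgeCoherence`

Route `CardyComplexCone` (sub-problem `CriticalPhenomena/CardyFormulaZ2`), crux
`Summit.CriticalPhenomena.CardyFormulaZ2.Theses.CardyComplexCone.EdgeCoherence` (item stmt-CriticalPhenomena-11385).
Helper file `--supports stmt-CriticalPhenomena-11385`: it proves, by name, the registered stub
`stub_identification : Sig.stub_identification` of the definitions module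
`Theorems/CardyComplexConeEdgeCoherenceLeeYangDefs.lean`, i.e. **IDENTIFICATION**: for admissible data `E` and a
nonzero reading mesh `δ`, the class harmonics of the spin-`1/3` corner observable are the rotated values of the
winding-index generating function at the physical fugacity,
`harmonic (fun _ => E) δ k v = i^{k·c₀} · indexGF E δ v (ζ₀ · i^k)`, `c₀ = (startCorner E).2`.

## Content and proof

Pathwise, along the exploration orbit `orb = cornerOrbit (E.bcBondConfig ω) (startCorner E)`:
* the passages of the path along the dart `(v, faceAt v c)` are the positions `n < len - 1` with `orb n = (v, c)`
  (`Negative.mem_dartFilter_iff`), and the integrand of `cornerObs` there is `orbitPhase n`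
  (`FixedRadiusCut.dartPhaseSum_orbit_form`);
* the winding of the prefix ending with the `n`-th dart is `(π/2) · T_n`, `T_n = Σ_{i<n} turnSign (orb i) ∈ ℤ`
  (`winding_orbitPts`: every step turns by `±π/2`), so the lifted quarter-turn index `round (W/(π/2))` is `T_n`
  exactly and `orbitPhase n = ζ₀ ^ T_n` (`zeta0 = exp(-iπ/6)`);
* the face class of the `n`-th dart is `c₀ + T_n (mod 4)`: `i^{c_n} = i^{c₀} · i^{T_n}` (`I_pow_snd_cornerOrbit`,
  induction on `n` over `nextCorner`), hence `i^{k c_n} ζ₀^{T_n} = i^{k c₀} (ζ₀ i^k)^{T_n}`.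
Summing over the darts at `v` and integrating (the integrands read only the finitely many edges of `Ω_δ`, hence are
integrable, `integrable_of_forall_inter`; the finite class sum and the constant `i^{k c₀}` commute with the integral)
gives the identity.

Sources: H. Duminil-Copin, S. Smirnov, *Conformal invariance of lattice models*, Clay Math. Proc. 15 (2012) §8;
S. Smirnov, Ann. of Math. 172 (2010) §2.2, §4 (the phase `e^{-iσW}`, face index ≡ number of turns); idea card
`Cruxes/EdgeCoherence/Ideas/lee-yang-winding-fugacity.md`. Everything is proved inline.
-/

noncomputable section

namespace Summit.CriticalPhenomena.CardyFormulaZ2.Cruxes.EdgeCoherence.LeeYang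

open scoped BigOperators Topology
open Filter Set MeasureTheory
open Literature.Probability.LatticeModels Literature.Probability.RandomPlanarGeometry
open Literature.Probability.Percolation (BondConfig bondPercolation half)
open Summit.CriticalPhenomena.CardyFormulaZ2.Cruxes.EdgeCoherence.FixedRadiusCut
  (cornerObs startCorner orbitPhase isStartCorner_startCorner dartPhaseSum_orbit_form
    medialExploration_inter_edgeSet edgeSet_finite integrable_of_forall_inter)
open Summit.CriticalPhenomena.CardyFormulaZ2.Theorems.EdgeCoherence.Negative
  (dartPhaseSum mem_dartFilter_iff medialExploration_eq_explorationList)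

/-! ### Algebra of the phases: `ζ₀ ^ T`, the face class along the orbit, the dictionary identity -/

/-- `ζ₀ ^ T = exp(-(i/3) · (π/2) · T)` for every integer `T`. -/
theorem zeta0_zpow (T : ℤ) :
    zeta0 ^ T = Complex.exp (-(Complex.I / 3) * ((Real.pi / 2 * (T : ℝ) : ℝ) : ℂ)) := by
  rw [zeta0, ← Complex.exp_int_mul]
  congr 1
  push_cast
  ring

/-- The orbit phase is a power of the physical fugacity: `orbitPhase n = ζ₀ ^ T_n`,
`T_n = Σ_{i<n} turnSign (orb i)`. -/
theorem orbitPhase_eq_zeta0_zpow (β' : BondConfig (Site 2)) (c₀ : Site 2 × Fin 4) (n : ℕ) :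
    orbitPhase β' c₀ n = zeta0 ^ (∑ i ∈ Finset.range n, turnSign β' (cornerOrbit β' c₀ i)) := by
  rw [zeta0_zpow, Int.cast_sum]
  rfl

/-- **The face class along the orbit** (as a power of `i`): `i^{c_n} = i^{c₀} · i^{T_n}` — following an open
edge turns right (class `+3 ≡ -1`, `turnSign = -1`), crossing a closed edge turns left (class `+1`,
`turnSign = +1`). -/
theorem I_pow_snd_cornerOrbit (β' : BondConfig (Site 2)) (c₀ : Site 2 × Fin 4) (n : ℕ) :
    (Complex.I : ℂ) ^ ((cornerOrbit β' c₀ n).2 : ℕ) =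
      Complex.I ^ (c₀.2 : ℕ) * Complex.I ^ (∑ i ∈ Finset.range n, turnSign β' (cornerOrbit β' c₀ i)) := by
  induction n with
  | zero => simp [cornerOrbit_zero']
  | succ n ih =>
    rw [Finset.sum_range_succ, zpow_add₀ Complex.I_ne_zero, ← mul_assoc, ← ih]
    change Complex.I ^ ((nextCorner β' (cornerOrbit β' c₀ n)).2 : ℕ) = _
    classical
    unfold turnSign
    split_ifs with h
    · rw [nextCorner_of_mem h]
      simp only [Int.reduceNeg, zpow_neg, zpow_one]
      rw [eq_mul_inv_iff_mul_eq₀ Complex.I_ne_zero]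
      exact I_pow_fin_add_three_mul_I _
    · rw [nextCorner_of_not_mem h, zpow_one]
      exact I_pow_fin_succ _

/-- **The dictionary identity** for one dart: `i^{k c_n} · orbitPhase n = i^{k c₀} · (ζ₀ i^k)^{T_n}`. -/
theorem I_pow_mul_orbitPhase (β' : BondConfig (Site 2)) (c₀ : Site 2 × Fin 4) (n k : ℕ) :
    Complex.I ^ (k * ((cornerOrbit β' c₀ n).2 : ℕ)) * orbitPhase β' c₀ n =
      Complex.I ^ (k * (c₀.2 : ℕ)) *
        (zeta0 * Complex.I ^ k) ^ (∑ i ∈ Finset.range n, turnSign β' (cornerOrbit β' c₀ i)) := by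
  rw [orbitPhase_eq_zeta0_zpow]
  set T := ∑ i ∈ Finset.range n, turnSign β' (cornerOrbit β' c₀ i) with hT
  have h1 : Complex.I ^ (k * ((cornerOrbit β' c₀ n).2 : ℕ)) =
      Complex.I ^ (k * (c₀.2 : ℕ)) * (Complex.I ^ k) ^ T := by
    rw [pow_mul', I_pow_snd_cornerOrbit, mul_pow, ← pow_mul', ← hT]
    congr 1
    rw [← zpow_natCast (Complex.I ^ T) k, ← zpow_natCast Complex.I k, ← zpow_mul, ← zpow_mul, mul_comm]
  rw [h1, mul_zpow]
  ring

/-! ### The exploration path: passages, windings and the two integrands along the orbit -/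

section Orbit

variable {E : DiscreteDobrushin} (hE : E.IsZdAdmissible)
include hE

/-- **The winding of the prefix ending with the `n`-th dart** is `(π/2) · T_n` (every step of the medial
exploration turns by `±π/2`, `winding_orbitPts`; the computation of `Negative.dartPhaseSum_eq_exp_turnSign`). -/
theorem winding_take_eq {c₀ : Site 2 × Fin 4} (hc₀ : E.IsStartCorner c₀) (ω : BondConfig (Site 2)) {δ : ℝ}
    (hδ : δ ≠ 0) (n : ℕ) (hn : n + 1 < (medialExploration E ω).length) :
    Polyline.winding (((medialExploration E ω).map (medialPoint δ)).take (n + 2)) =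
      Real.pi / 2 * ∑ i ∈ Finset.range n,
        (turnSign (E.bcBondConfig ω) (cornerOrbit (E.bcBondConfig ω) c₀ i) : ℝ) := by
  have hN := medialExploration_eq_explorationList hE hc₀ ω
  set N := (medialExploration E ω).length - 1 with hNdef
  rw [hN, map_medialPoint_explorationList, take_orbitPts δ c₀ (show n + 1 ≤ N by omega),
    Polyline.winding_eq_winding, winding_orbitPts hδ, sum_turnOf_eq]
  simp

/-- **Passages along the dart `(v, faceAt v c)` = orbit hits of `(v, c)` before the exit** (finset form of
`Negative.mem_dartFilter_iff`). -/
theorem dartFilter_eq (ω : BondConfig (Site 2)) (v : Site 2) (c : Fin 4) :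
    (Finset.range (medialExploration E ω).length).filter (fun n => (medialExploration E ω)[n]? =
        some (cornerSource v (faceAt v c)) ∧ (medialExploration E ω)[n + 1]? = some (cornerTarget v (faceAt v c))) =
      (Finset.range ((medialExploration E ω).length - 1)).filter
        (fun n => cornerOrbit (E.bcBondConfig ω) (startCorner E) n = (v, c)) := by
  ext n
  refine (mem_dartFilter_iff hE (isStartCorner_startCorner hE) ω (v, c) n).trans ?_
  rw [Finset.mem_filter, Finset.mem_range]
  constructor
  · rintro ⟨h1, h2⟩
    exact ⟨by omega, h2⟩
  · rintro ⟨h1, h2⟩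
    exact ⟨by omega, h2⟩

/-- **The integrand of `cornerObs` along the orbit**: the phase sum at the dart `(v, faceAt v c)` is the sum of
`orbitPhase n` over the orbit hits `n` of `(v, c)` before the exit. -/
theorem dartPhaseSum_faceAt_eq {δ : ℝ} (hδ : δ ≠ 0) (ω : BondConfig (Site 2)) (v : Site 2) (c : Fin 4) :
    dartPhaseSum (medialExploration E ω) δ v (faceAt v c) =
      ∑ n ∈ (Finset.range ((medialExploration E ω).length - 1)).filter
        (fun n => cornerOrbit (E.bcBondConfig ω) (startCorner E) n = (v, c)),
        orbitPhase (E.bcBondConfig ω) (startCorner E) n := by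
  rw [Finset.sum_filter]
  exact dartPhaseSum_orbit_form E hE δ hδ ω (v, c)

/-- **The integrand of `indexGF` along the orbit**: the class-`c` term at `v` is the sum of `ζ ^ T_n` over the
orbit hits `n` of `(v, c)` before the exit (the lifted index `round (W/(π/2))` is `T_n` exactly). -/
theorem indexTerm_eq {δ : ℝ} (hδ : δ ≠ 0) (ω : BondConfig (Site 2)) (v : Site 2) (c : Fin 4) (ζ : ℂ) :
    ∑ n ∈ (Finset.range (medialExploration E ω).length).filter (fun n => (medialExploration E ω)[n]? =
        some (cornerSource v (faceAt v c)) ∧ (medialExploration E ω)[n + 1]? = some (cornerTarget v (faceAt v c))),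
        ζ ^ (round (Polyline.winding (((medialExploration E ω).map (medialPoint δ)).take (n + 2)) /
          (Real.pi / 2)) : ℤ) =
      ∑ n ∈ (Finset.range ((medialExploration E ω).length - 1)).filter
        (fun n => cornerOrbit (E.bcBondConfig ω) (startCorner E) n = (v, c)),
        ζ ^ (∑ i ∈ Finset.range n, turnSign (E.bcBondConfig ω) (cornerOrbit (E.bcBondConfig ω) (startCorner E) i)) := by
  rw [dartFilter_eq hE ω v c]
  refine Finset.sum_congr rfl fun n hn => ?_
  obtain ⟨hn1, -⟩ := Finset.mem_filter.1 hn
  rw [Finset.mem_range] at hn1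
  rw [winding_take_eq hE (isStartCorner_startCorner hE) ω hδ n (by omega),
    mul_div_cancel_left₀ _ (by positivity : Real.pi / 2 ≠ 0)]
  congr 1
  exact_mod_cast round_intCast _

/-- The integrand of `cornerObs` reads only the edges of `Ω_δ`, hence is integrable under `P_{1/2}`. -/
theorem integrable_dartPhaseSum (δ : ℝ) (v f : Site 2) :
    Integrable (fun ω => dartPhaseSum (medialExploration E ω) δ v f) (bondPercolation (zdGraph 2) half) :=
  integrable_of_forall_inter (edgeSet_finite hE) (fun ω => by simp only [medialExploration_inter_edgeSet]) _ _

end Orbit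

/-! ### The stub -/

/-- **Stub IDENTIFICATION** (registered stub of line `Sketch`, composition `LeeYang`): for admissible data and a
nonzero reading mesh, `harmonic (fun _ => E) δ k v = i^{k c₀} · indexGF E δ v (ζ₀ i^k)` with `c₀ = (startCorner E).2`:
both sides are the integral of `Σ_{darts n of γ at v} i^{k c_n} ζ₀^{T_n} = i^{k c₀} Σ_n (ζ₀ i^k)^{T_n}`
(`I_pow_mul_orbitPhase` termwise along the orbit). -/
theorem stub_identification : Sig.stub_identification := by
  intro E δ hE hδ v k
  -- the left-hand side as one integral
  have hL : FixedRadiusCut.harmonic (fun _ => E) δ k v =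
      ∫ ω, ∑ c : Fin 4, Complex.I ^ (k * (c : ℕ)) * dartPhaseSum (medialExploration E ω) δ v (faceAt v c)
        ∂(bondPercolation (zdGraph 2) half) := by
    rw [integral_finsetSum _ fun c _ => (integrable_dartPhaseSum hE δ v (faceAt v c)).const_mul _]
    show ∑ c : Fin 4, Complex.I ^ (k * (c : ℕ)) * cornerObs E δ v (faceAt v c) = _
    refine Finset.sum_congr rfl fun c _ => ?_
    rw [integral_const_mul]
    rfl
  -- the right-hand side as one integral
  have hR : indexGF E δ v (zeta0 * Complex.I ^ k) =
      ∫ ω, ∑ c : Fin 4, ∑ n ∈ (Finset.range ((medialExploration E ω).length - 1)).filter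
          (fun n => cornerOrbit (E.bcBondConfig ω) (startCorner E) n = (v, c)),
        (zeta0 * Complex.I ^ k) ^ (∑ i ∈ Finset.range n,
          turnSign (E.bcBondConfig ω) (cornerOrbit (E.bcBondConfig ω) (startCorner E) i))
        ∂(bondPercolation (zdGraph 2) half) := by
    refine integral_congr_ae (ae_of_all _ fun ω => ?_)
    dsimp only
    exact Finset.sum_congr rfl fun c _ => indexTerm_eq hE hδ ω v c _
  rw [hL, hR, ← integral_const_mul]
  refine integral_congr_ae (ae_of_all _ fun ω => ?_)
  dsimp only
  rw [Finset.mul_sum]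
  refine Finset.sum_congr rfl fun c _ => ?_
  rw [dartPhaseSum_faceAt_eq hE hδ ω v c, Finset.mul_sum, Finset.mul_sum]
  refine Finset.sum_congr rfl fun n hn => ?_
  obtain ⟨-, hn2⟩ := Finset.mem_filter.1 hn
  have hc : (c : ℕ) = ((cornerOrbit (E.bcBondConfig ω) (startCorner E) n).2 : ℕ) := by rw [hn2]
  rw [hc]
  exact I_pow_mul_orbitPhase _ _ n k

end Summit.CriticalPhenomena.CardyFormulaZ2.Cruxes.EdgeCoherence.LeeYang

end
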